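import Summits.Ventures.HSemireg.WedgeHankelRecurrenceCompleteIntersection
import Summits.Ventures.HSemireg.WedgeHankelRecurrenceCompleteIntersectionTop

/-!
# Venture HSemireg — THE GENERATOR PAIR FROM LEVEL `N` TO LEVEL `N + 1` (the Euclid ∕ Berlekamp–Massey step): for a class `q` with `R^N(q) = r ≥ 1`, minimal recurrence `m` and second
# generator `g ∈ Rec^N_{N+2−r}(q)` (N56), put `δ := ⟪m, q⟫_{N+1−r}` and `ε := ⟪g, q⟫_{r−1}` (the two DISCREPANCIES at the new coefficient `q_{N+1}`).  **If `δ = 0` the pair `(m, g)` is again a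
# generator pair at level `N + 1` (windows `r`, `N + 3 − r`); if `δ ≠ 0` the rank steps up and `(m, δ·g − ε·X^{N+2−2r}·m)` is a generator pair at level `N + 1`** (windows `r + 1`, `N + 2 − r`;
# at `2r = N + 1` it is N59's basis of the two-dimensional top window); a polar class always has `δ ≠ 0`

HONEST FRAMING. Part of the Lean index of the computation cell `pub-hsemireg` (seat p10 gen 30, Sunday typer «UNIFORM-IN-n»).
LINEAR ALGEBRA OF HANKEL (catalecticant) MATRICES and of polynomials over a field ONLY: no variety, no cohomology theory, no sheaf, no Ext group and no semiregularity map is constructed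
here; nothing here says that HC / HC_CM / HC_AV holds; no Literature fact is declared or used.  Custodian versions as in `WedgeHankelSiegelIdeal` (1/3); the dictionary («discrepancy»,
Berlekamp 1968 ∕ Massey 1969; the step `(m, g) ↦ (m, δ g − ε X^k m)` = one step of the Euclidean algorithm ∕ continued fraction of the symbol, Mills 1975, Welch–Scholtz 1979) is QUOTED in
docstrings, never asserted — with N56 ∕ N59 ∕ N62 (every recurrence space from ANY generator pair) the whole recurrence module at level `N + 1` is thereby explicit from level `N`.

WHAT IS IN THE TREE.  N56 (`WedgeHankelRecurrenceCompleteIntersection`, № 380): the second generator `g ∈ Rec^N_{N+2−r}(q) ∖ m·K[X]_{≤ N+2−2r}`, `isCoprime_of_not_mem`, `natDegree_eq_of_not_mem_of_natDegree_lt`,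
`recSpace_beyond_eq_sup_of_not_mem`, `mem_recSpace_of_X_mul_mem`; N59 (№ 386) `recSpace_top_eq_sup_of_not_mem` (top window from any independent pair); N41 (`WedgeHankelRecurrenceExtension`, № 299)
`mem_recSpace_succ_iff_hkFun_eq_zero` (THE DISCREPANCY: `m ∈ Rec^{N+1}_d(q) ↔ ⟪m, q⟫_{N+1−d} = 0`); N42 (№ 313) `rank_half_level_succ_of_mem` ∕ `_of_not_mem`; N43 (№ 323) `IsPolarClass.rank_level_succ`,
`isAffineClass_or_isPolarClass`; N29 (№ 237) `mem_recSpace_succ_succ_iff`; N18 (№ 173) `mem_recSpace_iff`, `hkFun_X_pow_mul`, `X_mul_mem_recSpace_succ`, `recSpace_eq_bot_of_lt`, `natDegree_le_of_mem_recSpace`,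
`mem_degreeLT_succ_iff`, `recSpace_le_degreeLT`.  Mathlib: `IsCoprime.sub_mul_right_right_iff`, `isCoprime_mul_unit_left_right`, `IsCoprime.isUnit_of_dvd'`, `Polynomial.natDegree_eq_zero_of_isUnit`.
THIS FILE (namespace `Summit.Ventures.HSemireg.Wedge.HankelOuter` continued; PLAIN on N56 + N59; 0 definitions).  `δ := hkFun K q (N + 1 − r) m`, `ε := hkFun K q (r − 1) g` written out.
* §629 LEVEL `N → N + 1` FOR ONE RECURRENCE: `mem_recSpace_level_succ_succ` (`Rec^N_k ⊆ Rec^{N+1}_{k+1}`), **`X_mul_mem_recSpace_level_succ_iff`** (`k ≤ N`, `p ∈ Rec^N_k(q)`: `X·p ∈ Rec^{N+1}_{k+1}(q)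
  ↔ ⟪p, q⟫_{N+1−k} = 0`), **`hkFun_ne_zero_of_isPolarClass`** (a POLAR class has non-zero discrepancy `δ ≠ 0`, `2r ≤ N + 1`), `hkFun_eq_zero_iff_isAffineClass_level_succ` (affine: `δ = 0 ↔` affine
  of rank `r` at level `N + 1`).
* §630 THE STEP: **`smul_sub_smul_mem_recSpace_level_succ`** (`δ·g − ε·X^{N+2−2r}·m ∈ Rec^{N+1}_{N+2−r}(q)` — the one new condition cancels), `isCoprime_smul_sub_smul` (`δ ≠ 0 ⇒` prime to `m`),
  `not_mem_map_mulRight_of_isCoprime_of_natDegree_pos`; **`generatorPair_level_succ_of_hkFun_eq_zero`** (`δ = 0`: rank `r`, pair `(m, g)` with windows `(r, N + 3 − r)` at level `N + 1`),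
  **`generatorPair_level_succ_of_hkFun_ne_zero`** (`δ ≠ 0`, `2r ≤ N`: rank `r + 1`, pair `(m, δ g − ε X^{N+2−2r} m)` with windows `(r + 1, N + 2 − r)`),
  **`generatorPair_level_succ_top_of_hkFun_ne_zero`** (`δ ≠ 0`, `2r = N + 1`: rank `r + 1` = top of the even level `N + 1 = 2r`, and `m`, `δ g − ε X·m` are N59's independent pair in `Rec^{2r}_{r+1}`).
Nothing Ext-side.  New names only.
-/

open Module Polynomial
open scoped Matrix Polynomial

namespace Summit.Ventures.HSemireg.Wedge.HankelOuter

open Summit.Ventures.HSemireg.Wedge Summit.Ventures.HSemireg.Wedge.Hankel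

variable (K : Type*) [Field K] {N : ℕ}

/-! ## §629. One recurrence from level `N` to level `N + 1`: the discrepancy -/

/-- `Rec^N_k(q) ⊆ Rec^{N+1}_{k+1}(q)`: the conditions are the same, the degree bound is weaker. -/
theorem mem_recSpace_level_succ_succ {k : ℕ} {q : ℕ → K} {p : K[X]} (hp : p ∈ recSpace K N q k) : p ∈ recSpace K (N + 1) q (k + 1) :=
  (mem_recSpace_succ_succ_iff K (recSpace_le_degreeLT K q k hp)).mpr hp

/-- **`X·p ∈ Rec^{N+1}_{k+1}(q) ↔ ⟪p, q⟫_{N+1−k} = 0`** for `p ∈ Rec^N_k(q)`, `k ≤ N`: multiplying by `X` shifts the conditions by one, and the only new one is the DISCREPANCY of `p`. -/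
theorem X_mul_mem_recSpace_level_succ_iff {k : ℕ} (hk : k ≤ N) {q : ℕ → K} {p : K[X]} (hp : p ∈ recSpace K N q k) :
    Polynomial.X * p ∈ recSpace K (N + 1) q (k + 1) ↔ hkFun K q (N + 1 - k) p = 0 := by
  rw [mem_recSpace_iff] at hp
  rw [mem_recSpace_iff]
  constructor
  · rintro ⟨-, h⟩
    have h1 := h (N - k) (by omega)
    rwa [hkFun_X_mul, show N - k + 1 = N + 1 - k by omega] at h1
  · intro h
    refine ⟨?_, fun s hs => ?_⟩
    · rw [mem_degreeLT_succ_iff] at hp ⊢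
      exact (Polynomial.natDegree_mul_le).trans (by have := Polynomial.natDegree_X_le (R := K); omega)
    · rw [hkFun_X_mul]
      rcases Nat.lt_or_ge (s + 1 + k) (N + 1) with hlt | hge
      · exact hp.2 (s + 1) (by omega)
      · rw [show s + 1 = N + 1 - k by omega]; exact h

/-- **A POLAR CLASS HAS NON-ZERO DISCREPANCY: `IsPolarClass K N r q`, `2r ≤ N + 1`, `0 ≠ m ∈ Rec^N_r(q) ⇒ ⟪m, q⟫_{N+1−r} ≠ 0`** (otherwise `m ∈ Rec^{N+1}_r(q) = 0`, the rank at level `N + 1`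
being `r + 1`, N43). -/
theorem hkFun_ne_zero_of_isPolarClass {r : ℕ} {q : ℕ → K} (hP : IsPolarClass K N r q) (h2 : r + r ≤ N + 1) {m : K[X]} (hm : m ∈ recSpace K N q r) (hm0 : m ≠ 0) :
    hkFun K q (N + 1 - r) m ≠ 0 := by
  intro h
  have hmem : m ∈ recSpace K (N + 1) q r := (mem_recSpace_succ_iff_hkFun_eq_zero K (by omega) hm).mpr h
  rw [recSpace_eq_bot_of_lt K (hP.rank_level_succ h2) (Nat.lt_succ_self r), Submodule.mem_bot] at hmem
  exact hm0 hmem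

/-- **for an AFFINE class the discrepancy decides: `⟪m, q⟫_{N+1−r} = 0 ↔` the class is affine of rank `r` at level `N + 1`** (`m` a full-degree generator, `2r ≤ N + 1`; N43 + N41). -/
theorem hkFun_eq_zero_iff_isAffineClass_level_succ {r : ℕ} {q : ℕ → K} (hA : IsAffineClass K N r q) (h2 : r + r ≤ N + 1) {m : K[X]} (hm : m ∈ recSpace K N q r) (hm0 : m ≠ 0)
    (hmd : m.natDegree = r) : hkFun K q (N + 1 - r) m = 0 ↔ IsAffineClass K (N + 1) r q := by
  rw [hA.isAffineClass_level_succ_iff h2 hm hm0 hmd, mem_recSpace_succ_iff_hkFun_eq_zero K (by omega) hm]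

/-! ## §630. The step: the new generator pair -/

/-- **THE NEW SECOND GENERATOR: `δ·g − ε·X^{N+2−2r}·m ∈ Rec^{N+1}_{N+2−r}(q)`** for `m ∈ Rec^N_r(q)`, `g ∈ Rec^N_{N+2−r}(q)`, `1 ≤ r`, `2r ≤ N + 2`, `δ = ⟪m, q⟫_{N+1−r}`, `ε = ⟪g, q⟫_{r−1}`: both
terms satisfy the old conditions `s ≤ r − 2`, and at the one new condition `s = r − 1` the discrepancies cancel, `δ·ε − ε·δ = 0`. -/
theorem smul_sub_smul_mem_recSpace_level_succ {r : ℕ} {q : ℕ → K} {m g : K[X]} (hr : 1 ≤ r) (h2 : r + r ≤ N + 2) (hm : m ∈ recSpace K N q r) (hg : g ∈ recSpace K N q (N + 2 - r)) :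
    hkFun K q (N + 1 - r) m • g - hkFun K q (r - 1) g • (Polynomial.X ^ (N + 2 - r - r) * m) ∈ recSpace K (N + 1) q (N + 2 - r) := by
  have hm' := (mem_recSpace_iff K).mp hm
  have hg' := (mem_recSpace_iff K).mp hg
  refine (mem_recSpace_iff K).mpr ⟨Submodule.sub_mem _ (Submodule.smul_mem _ _ hg'.1) (Submodule.smul_mem _ _ ?_), fun s hs => ?_⟩
  · rw [mem_degreeLT_succ_iff] at hm' ⊢
    exact (Polynomial.natDegree_mul_le).trans (by rw [Polynomial.natDegree_X_pow]; omega)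
  · rw [map_sub, map_smul, map_smul, hkFun_X_pow_mul, smul_eq_mul, smul_eq_mul]
    rcases Nat.lt_or_ge (s + 1) r with hlt | hge
    · rw [hg'.2 s (by omega), hm'.2 (s + (N + 2 - r - r)) (by omega), mul_zero, mul_zero, sub_zero]
    · rw [show s = r - 1 by omega, show r - 1 + (N + 2 - r - r) = N + 1 - r by omega, mul_comm, sub_self]

/-- the new second generator is prime to `m` when `δ ≠ 0` and `gcd(m, g) = 1`. -/
theorem isCoprime_smul_sub_smul {m g : K[X]} (hcop : IsCoprime m g) {δ ε : K} (hδ : δ ≠ 0) (k : ℕ) : IsCoprime m (δ • g - ε • (Polynomial.X ^ k * m)) := by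
  rw [Polynomial.smul_eq_C_mul, Polynomial.smul_eq_C_mul, ← mul_assoc, IsCoprime.sub_mul_right_right_iff,
    isCoprime_mul_unit_left_right (Polynomial.isUnit_C.mpr (isUnit_iff_ne_zero.mpr hδ))]
  exact hcop

/-- a polynomial prime to a NON-CONSTANT `m` is not a multiple of `m`. -/
theorem not_mem_map_mulRight_of_isCoprime_of_natDegree_pos {m g : K[X]} (hcop : IsCoprime m g) (hmd : 0 < m.natDegree) (n : ℕ) :
    g ∉ (Polynomial.degreeLT K n).map (LinearMap.mulRight K m) := by
  rintro ⟨h, -, rfl⟩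
  rw [LinearMap.mulRight_apply] at hcop
  have hu : IsUnit m := hcop.isUnit_of_dvd' (dvd_refl m) (dvd_mul_left m h)
  have := Polynomial.natDegree_eq_zero_of_isUnit hu
  omega

variable {K} in
/-- `deg (δ·g − ε·p) = deg g` when `δ ≠ 0` and `deg p < deg g`. -/
theorem natDegree_smul_sub_smul {g p : K[X]} {δ ε : K} (hδ : δ ≠ 0) (hlt : p.natDegree < g.natDegree) : (δ • g - ε • p).natDegree = g.natDegree := by
  have h1 : (δ • g).natDegree = g.natDegree := by rw [Polynomial.smul_eq_C_mul, Polynomial.natDegree_C_mul hδ]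
  rw [Polynomial.natDegree_sub_eq_left_of_natDegree_lt ((Polynomial.natDegree_smul_le ε p).trans_lt (hlt.trans_eq h1.symm)), h1]

section Step

variable {K}
variable {r : ℕ} {q : ℕ → K} {m g : K[X]} (hq : (hankel1 K N (N / 2) q).rank = r) (hr : 1 ≤ r) (hm : m ∈ recSpace K N q r) (hm0 : m ≠ 0)
  (hg : g ∈ recSpace K N q (N + 2 - r)) (hgA : g ∉ (Polynomial.degreeLT K (N + 2 - r - r + 1)).map (LinearMap.mulRight K m))
include hq hr hm hm0 hg hgA

/-- **THE STEP WHEN `δ = 0` (the new coefficient continues `m`; `2r ≤ N + 1`): the class is AFFINE of rank `r` at both levels, and `(m, g)` IS A GENERATOR PAIR AT LEVEL `N + 1` with windows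
`(r, N + 3 − r)`: `R^{N+1}(q) = r`, `m ∈ Rec^{N+1}_r(q)`, `g ∈ Rec^{N+1}_{N+3−r}(q) ∖ m·K[X]_{≤ N+3−2r}`** (so N56's complete intersection at level `N + 1` is spanned by the same pair). -/
theorem generatorPair_level_succ_of_hkFun_eq_zero (h2 : r + r ≤ N + 1) (hδ : hkFun K q (N + 1 - r) m = 0) :
    (hankel1 K (N + 1) ((N + 1) / 2) q).rank = r ∧ m.natDegree = r ∧ m ∈ recSpace K (N + 1) q r ∧ g ∈ recSpace K (N + 1) q (N + 1 + 2 - r) ∧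
      g ∉ (Polynomial.degreeLT K (N + 1 + 2 - r - r + 1)).map (LinearMap.mulRight K m) := by
  -- the class is affine at level `N`: a polar class has `δ ≠ 0`
  have hmd : m.natDegree = r := by
    rcases isAffineClass_or_isPolarClass K hq with hA | hP
    · obtain ⟨-, m', hm', hm'0, hm'd⟩ := hA
      rw [natDegree_eq_of_mem_recSpace_self K hq h2 hm' hm'0 hm hm0, hm'd]
    · exact absurd hδ (hkFun_ne_zero_of_isPolarClass K hP h2 hm hm0)
  have hmem : m ∈ recSpace K (N + 1) q r := (mem_recSpace_succ_iff_hkFun_eq_zero K (by omega) hm).mpr hδ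
  have hcop : IsCoprime m g := isCoprime_of_not_mem K hq hr h2 hm hm0 hg hgA
  refine ⟨rank_half_level_succ_of_mem K hq hm hm0 hmd h2 hmem, hmd, hmem, ?_, not_mem_map_mulRight_of_isCoprime_of_natDegree_pos K hcop (by omega) _⟩
  rw [show N + 1 + 2 - r = N + 2 - r + 1 by omega]
  exact mem_recSpace_level_succ_succ K hg

/-- **THE STEP WHEN `δ ≠ 0` (the new coefficient breaks `m`; `2r ≤ N`): the rank steps up to `r + 1` and `(m, δ·g − ε·X^{N+2−2r}·m)` IS A GENERATOR PAIR AT LEVEL `N + 1` with windows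
`(r + 1, N + 2 − r)`: `m ∈ Rec^{N+1}_{r+1}(q)` (the class is POLAR there), `δ g − ε X^{N+2−2r} m ∈ Rec^{N+1}_{N+2−r}(q) ∖ m·K[X]_{≤ N+1−2r}`, and the pair is coprime** — one step of the
Euclidean algorithm on the symbol (Berlekamp–Massey). -/
theorem generatorPair_level_succ_of_hkFun_ne_zero (h2 : r + r ≤ N) (hδ : hkFun K q (N + 1 - r) m ≠ 0) :
    (hankel1 K (N + 1) ((N + 1) / 2) q).rank = r + 1 ∧ m ∈ recSpace K (N + 1) q (r + 1) ∧
      hkFun K q (N + 1 - r) m • g - hkFun K q (r - 1) g • (Polynomial.X ^ (N + 2 - r - r) * m) ∈ recSpace K (N + 1) q (N + 1 + 2 - (r + 1)) ∧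
      hkFun K q (N + 1 - r) m • g - hkFun K q (r - 1) g • (Polynomial.X ^ (N + 2 - r - r) * m) ∉ (Polynomial.degreeLT K (N + 1 + 2 - (r + 1) - (r + 1) + 1)).map (LinearMap.mulRight K m) ∧
      IsCoprime m (hkFun K q (N + 1 - r) m • g - hkFun K q (r - 1) g • (Polynomial.X ^ (N + 2 - r - r) * m)) := by
  have hcop : IsCoprime m g := isCoprime_of_not_mem K hq hr (by omega) hm hm0 hg hgA
  have hcop' := isCoprime_smul_sub_smul K hcop hδ (N + 2 - r - r) (ε := hkFun K q (r - 1) g)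
  have hmem' := smul_sub_smul_mem_recSpace_level_succ K hr (by omega) hm hg
  have hnot : m ∉ recSpace K (N + 1) q r := fun h => hδ ((mem_recSpace_succ_iff_hkFun_eq_zero K (by omega) hm).mp h)
  refine ⟨rank_half_level_succ_of_not_mem K hq hm (by omega) hnot, mem_recSpace_level_succ_succ K hm, by rw [show N + 1 + 2 - (r + 1) = N + 2 - r by omega]; exact hmem', ?_, hcop'⟩
  rw [show N + 1 + 2 - (r + 1) - (r + 1) + 1 = N + 1 - r - r + 1 by omega]
  rcases Nat.eq_zero_or_pos m.natDegree with hmd | hmd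
  · -- `m` is a non-zero constant (a polar class): `g` has full degree `N + 2 − r` (N56), so has the new generator, while `m·K[X]_{≤ N+1−2r}` stops at degree `N + 1 − 2r`
    have hgd : g.natDegree = N + 2 - r := natDegree_eq_of_not_mem_of_natDegree_lt K hq (by omega) hm hm0 (by omega) hg hgA
    have hdeg : (hkFun K q (N + 1 - r) m • g - hkFun K q (r - 1) g • (Polynomial.X ^ (N + 2 - r - r) * m)).natDegree = N + 2 - r := by
      rw [natDegree_smul_sub_smul hδ ((Polynomial.natDegree_mul_le).trans_lt (by rw [Polynomial.natDegree_X_pow, hmd, hgd]; omega)), hgd]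
    rintro ⟨h, hh, hEq⟩
    have h1 : (h * m).natDegree ≤ N + 1 - r - r := (Polynomial.natDegree_mul_le).trans (by rw [hmd, add_zero]; exact (mem_degreeLT_succ_iff K).mp hh)
    rw [LinearMap.mulRight_apply] at hEq
    rw [hEq, hdeg] at h1
    omega
  · exact not_mem_map_mulRight_of_isCoprime_of_natDegree_pos K hcop' hmd _

/-- **THE STEP WHEN `δ ≠ 0` AT THE EDGE `2r = N + 1`: the rank steps up to the TOP rank `r + 1` of the even level `N + 1 = 2r`, and `m`, `δ·g − ε·X·m` are two INDEPENDENT members of the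
two-dimensional top window `Rec^{N+1}_{r+1}(q)`** (N59's pair: `Rec^{N+1}_{r+1+j} = m·K[X]_{≤ j} ⊕ (δ g − ε X m)·K[X]_{≤ j}` for `j ≤ r` follows from `recSpace_top_eq_sup_of_not_mem`). -/
theorem generatorPair_level_succ_top_of_hkFun_ne_zero (h2 : r + r = N + 1) (hδ : hkFun K q (N + 1 - r) m ≠ 0) :
    (hankel1 K (N + 1) ((N + 1) / 2) q).rank = r + 1 ∧ m ∈ recSpace K (N + 1) q (r + 1) ∧
      hkFun K q (N + 1 - r) m • g - hkFun K q (r - 1) g • (Polynomial.X ^ (N + 2 - r - r) * m) ∈ recSpace K (N + 1) q (r + 1) ∧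
      hkFun K q (N + 1 - r) m • g - hkFun K q (r - 1) g • (Polynomial.X ^ (N + 2 - r - r) * m) ∉ (Polynomial.degreeLT K (0 + 1)).map (LinearMap.mulRight K m) ∧
      IsCoprime m (hkFun K q (N + 1 - r) m • g - hkFun K q (r - 1) g • (Polynomial.X ^ (N + 2 - r - r) * m)) := by
  have e1 : N + 2 - r - r = 1 := by omega
  have hcop : IsCoprime m g := isCoprime_of_not_mem K hq hr (by omega) hm hm0 hg hgA
  have hcop' := isCoprime_smul_sub_smul K hcop hδ (N + 2 - r - r) (ε := hkFun K q (r - 1) g)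
  have hmem' := smul_sub_smul_mem_recSpace_level_succ K hr (by omega) hm hg
  rw [e1] at hcop' hmem' ⊢
  rw [show N + 2 - r = r + 1 by omega] at hmem'
  have hnot : m ∉ recSpace K (N + 1) q r := fun h => hδ ((mem_recSpace_succ_iff_hkFun_eq_zero K (by omega) hm).mp h)
  refine ⟨rank_half_level_succ_of_not_mem K hq hm (by omega) hnot, mem_recSpace_level_succ_succ K hm, hmem', ?_, hcop'⟩
  rcases Nat.eq_zero_or_pos m.natDegree with hmd | hmd
  · have hgd : g.natDegree = N + 2 - r := natDegree_eq_of_not_mem_of_natDegree_lt K hq (by omega) hm hm0 (by omega) hg hgA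
    have hdeg : (hkFun K q (N + 1 - r) m • g - hkFun K q (r - 1) g • (Polynomial.X ^ 1 * m)).natDegree = N + 2 - r := by
      rw [natDegree_smul_sub_smul hδ ((Polynomial.natDegree_mul_le).trans_lt (by rw [Polynomial.natDegree_X_pow, hmd, hgd]; omega)), hgd]
    rintro ⟨h, hh, hEq⟩
    have h1 : (h * m).natDegree ≤ 0 := (Polynomial.natDegree_mul_le).trans (by rw [hmd, add_zero]; exact (mem_degreeLT_succ_iff K).mp hh)
    rw [LinearMap.mulRight_apply] at hEq
    rw [hEq, hdeg] at h1
    omega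
  · exact not_mem_map_mulRight_of_isCoprime_of_natDegree_pos K hcop' hmd _

end Step

end Summit.Ventures.HSemireg.Wedge.HankelOuter
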